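import Mathlib
import Summits.PneNP.PneNP.Theorems.OverlapGapAlgebraSearchHardWindowBlockWalk
import Summits.PneNP.PneNP.Theorems.OverlapGapAlgebraSearchHardWindowBlockPad
import Summits.PneNP.PneNP.Theorems.OverlapGapAlgebraSearchHardWindowScanCorrelation

/-!
# Route OverlapGapAlgebra, crux `SearchHardWindow` (stmt-PneNP-2460): the scan correlation
# inequality on Bresler–Huang path tuples read at CHECKPOINTS (blocks of `L` literals)

Block form of `scanCorrelation_paths` (`…ScanPaths.lean`). Group the `m·k` literal slots of an
instance `Fin m → Fin k → Fin n × Bool` into consecutive BLOCKS of `L` slots in the lexicographic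
(Bresler–Huang) order, padding the last block (`blk_padEquiv : padded ≃ instances × junk`,
`…BlockPad.lean`). On padded instances the interpolation path with checkpoints is LITERALLY the
single-symbol splice path over the block alphabet `Fin L → Fin n × Bool` (`blk_pathIsWalk`,
`…BlockWalk.lean`), so the abstract `scc_count` + `scc_defect_le` (`…ScanCorrelation.lean`) apply with
`T' = k·(m'·k)` block steps.

**Theorem (`scanCorrelation_blockPaths`).** The path tuples all of whose CHECKPOINT splice points
`(r, i·L)`, `i ≤ m'·k`, lie in `G` and none of whose consecutive checkpoint pairs is `Far` number at
least `#paths · p^{k·(m'k)+1} · exp(−defect)`: the success set pays `p^{k(m'k)+1} ≈ p^{k²m/L}`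
instead of the `p^{k²m+1}` of the single-literal form — the point of the macro-step line.

References: G. Bresler, B. Huang, arXiv:2106.02129, Def. 4.2 [BreslerHuang2022]; B. Huang,
M. Sellke, arXiv:2501.06427, Lemma 3.1 [HuangSellke2025] (correlation for reversible ensembles).
-/

namespace Summit.PneNP.PneNP.Theorems

set_option linter.dupNamespace false -- `Summit.PneNP.PneNP.…`: summit = sub-problem (D-0017)

open Finset
open scoped Classical

/-! ### The correlation inequality on checkpointed path tuples -/

/-- **The scan correlation inequality on Bresler–Huang path tuples read at checkpoints.** Let
`n, L ≥ 1`, `m ≤ m'·L`, and let `e` be a padding equivalence as supplied by `blk_padEquiv` (padded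
instances `Fin m' → Fin k → (Fin L → Fin n × Bool)` ≃ instances × junk, the instance component
reading slot `(a, c)` from block `(a·k+c)/L`). For a nonempty set `G` of instances of density
`p = #G/#instances`, a symmetric irreflexive relation `Far`, and a bound `B` on the number of
(padded instance, block, fresh block-symbol) triples whose block replacement is a `Far` pair of
instances, the path tuples `Ψ` all of whose checkpoint splice points `(r, i·L)`, `i ≤ m'·k`, lie in
`G` and none of whose consecutive checkpoint pairs is `Far` number at least
`#paths · p^{k·(m'k)+1} · exp(−(2 log(2N̂)/(#G·N^{m'kL−mk})) · √(N̂^{m'k}/N̂) · √(k(m'k)·(k·B)))`,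
`N = 2n`, `N̂ = N^L` (the abstract `scc_count` + `scc_defect_le` for the block walk `blk_pathIsWalk`
over the alphabet `Fin L → Fin n × Bool`, transported along `e`). [BreslerHuang2022, Def. 4.2;
HuangSellke2025, Lemma 3.1] -/
theorem scanCorrelation_blockPaths (k m n L m' : ℕ) (hn : 1 ≤ n) (hL : 1 ≤ L)
    (e : (Fin m' → Fin k → Fin L → Fin n × Bool) ≃
      (Fin m → Fin k → Fin n × Bool) × (Fin (m' * k * L - m * k) → Fin n × Bool))
    (he : ∀ (a : Fin m) (c : Fin k), ∃ (a' : Fin m') (c' : Fin k) (o : Fin L),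
      (a' : ℕ) * k + c' = ((a : ℕ) * k + c) / L ∧
        ∀ Φ : Fin m' → Fin k → Fin L → Fin n × Bool, (e Φ).1 a c = Φ a' c' o)
    (G : Finset (Fin m → Fin k → Fin n × Bool)) (hG : G.Nonempty)
    (Far : (Fin m → Fin k → Fin n × Bool) → (Fin m → Fin k → Fin n × Bool) → Prop)
    (hsymm : ∀ Φ Φ', Far Φ Φ' → Far Φ' Φ) (hirr : ∀ Φ, ¬ Far Φ Φ) (B : ℝ)
    (hB : (∑ a' : Fin m', ∑ c' : Fin k,
        (((Finset.univ : Finset ((Fin m' → Fin k → Fin L → Fin n × Bool) × (Fin L → Fin n × Bool))).filter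
          fun p => Far (e p.1).1
            (e (Function.update p.1 a' (Function.update (p.1 a') c' p.2))).1).card : ℝ)) ≤ B) :
    (Fintype.card (Fin (k + 1) → Fin m → Fin k → Fin n × Bool) : ℝ) *
        ((G.card : ℝ) / Fintype.card (Fin m → Fin k → Fin n × Bool)) ^ (k * (m' * k) + 1) *
        Real.exp (-(2 * Real.log (2 * (2 * n : ℝ) ^ L) /
            (G.card * (2 * n : ℝ) ^ (m' * k * L - m * k)) *
          Real.sqrt (((2 * n : ℝ) ^ L) ^ (m' * k) / (2 * n : ℝ) ^ L) *
          Real.sqrt ((k * (m' * k) : ℕ) * (k * B))))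
      ≤ (((univ : Finset (Fin (k + 1) → Fin m → Fin k → Fin n × Bool)).filter fun Ψ =>
          (∀ r : Fin k, ∀ i ≤ m' * k,
            (fun (a : Fin m) (b : Fin k) =>
              if (a : ℕ) * k + b < i * L then Ψ r.succ a b else Ψ r.castSucc a b) ∈ G) ∧
          ∀ r : Fin k, ∀ i < m' * k,
            ¬ Far (fun (a : Fin m) (b : Fin k) =>
                if (a : ℕ) * k + b < i * L then Ψ r.succ a b else Ψ r.castSucc a b)
              (fun (a : Fin m) (b : Fin k) =>
                if (a : ℕ) * k + b < (i + 1) * L then Ψ r.succ a b else Ψ r.castSucc a b)).card : ℝ) := by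
  have hL0 : 0 < L := hL
  -- the abstract block walk (opaque objects, as in `scanCorrelation_paths`)
  set T : ℕ := k * (m' * k) with hT
  obtain ⟨σ, pos, hσ, hpos0, hposS⟩ :
      ∃ (σ : Fin T → Fin m' × Fin k) (pos : (Fin m' × Fin k → (Fin L → Fin n × Bool)) →
        (Fin T → (Fin L → Fin n × Bool)) → ℕ → (Fin m' × Fin k → (Fin L → Fin n × Bool))),
        (∀ t, ((σ t).1 : ℕ) = (t : ℕ) % (m' * k) / k ∧ ((σ t).2 : ℕ) = (t : ℕ) % (m' * k) % k) ∧
        (∀ v U, pos v U 0 = v) ∧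
        ∀ v U (t : Fin T), pos v U ((t : ℕ) + 1) = Function.update (pos v U t) (σ t) (U t) :=
    blk_walkData (Fin L → Fin n × Bool) k m'
  obtain ⟨InG, hInG⟩ : ∃ InG : (Fin m' × Fin k → (Fin L → Fin n × Bool)) → Prop,
      ∀ v, InG v ↔ (e (Function.curry v)).1 ∈ G := ⟨_, fun _ => Iff.rfl⟩
  obtain ⟨St, hSt⟩ : ∃ St : (Fin m' × Fin k → (Fin L → Fin n × Bool)) →
      (Fin m' × Fin k → (Fin L → Fin n × Bool)) → Prop,
      ∀ v w, St v w ↔ ¬ Far (e (Function.curry v)).1 (e (Function.curry w)).1 :=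
    ⟨_, fun _ _ => Iff.rfl⟩
  have hrefl : ∀ v, St v v := fun v => (hSt v v).2 (hirr _)
  have hsymm' : ∀ v w, St v w → St w v := fun v w h =>
    (hSt w v).2 fun h' => (hSt v w).1 h (hsymm _ _ h')
  -- cardinalities
  haveI : Nonempty (Fin n × Bool) := ⟨(⟨0, hn⟩, true)⟩
  have hS : 0 < Fintype.card (Fin L → Fin n × Bool) := Fintype.card_pos
  have hcSB : (Fintype.card (Fin L → Fin n × Bool) : ℝ) = (2 * n) ^ L := by
    rw [Fintype.card_fun, Fintype.card_prod, Fintype.card_fin, Fintype.card_bool, Fintype.card_fin]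
    push_cast; ring
  have hcV : (Fintype.card (Fin m' × Fin k → (Fin L → Fin n × Bool)) : ℝ) = ((2 * n) ^ L) ^ (m' * k) := by
    rw [Fintype.card_fun, Fintype.card_prod, Fintype.card_fin, Fintype.card_fin, ← hcSB]
    push_cast; ring
  have hcJ : (Fintype.card (Fin (m' * k * L - m * k) → Fin n × Bool) : ℝ) =
      (2 * n) ^ (m' * k * L - m * k) := by
    simp only [Fintype.card_fun, Fintype.card_prod, Fintype.card_fin, Fintype.card_bool]
    push_cast; ring
  have hcPI : Fintype.card (Fin m' → Fin k → Fin L → Fin n × Bool) =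
      Fintype.card (Fin m → Fin k → Fin n × Bool) * Fintype.card (Fin (m' * k * L - m * k) → Fin n × Bool) := by
    rw [Fintype.card_congr e, Fintype.card_prod]
  have hcVPI : Fintype.card (Fin m' × Fin k → (Fin L → Fin n × Bool)) =
      Fintype.card (Fin m' → Fin k → Fin L → Fin n × Bool) :=
    Fintype.card_congr (Equiv.curry _ _ _)
  have hJpos : (0 : ℝ) < Fintype.card (Fin (m' * k * L - m * k) → Fin n × Bool) := by
    exact_mod_cast Fintype.card_pos
  -- the good set upstairs is `G × junk`
  have hGcard : ((univ : Finset (Fin m' × Fin k → (Fin L → Fin n × Bool))).filter InG).card =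
      G.card * Fintype.card (Fin (m' * k * L - m * k) → Fin n × Bool) := by
    rw [← Finset.card_univ, ← Finset.card_product]
    refine Finset.card_equiv ((Equiv.curry (Fin m') (Fin k) (Fin L → Fin n × Bool)).trans e)
      fun v => ?_
    simp only [mem_filter, mem_univ, true_and, hInG, Finset.mem_product, and_true, Equiv.trans_apply]
    exact Iff.rfl
  have hGpos : (0 : ℝ) < G.card := by exact_mod_cast Finset.card_pos.2 hG
  have hG' : 0 < ((univ : Finset (Fin m' × Fin k → (Fin L → Fin n × Bool))).filter InG).card := by
    rw [hGcard]; exact Nat.mul_pos (Finset.card_pos.2 hG) Fintype.card_pos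
  -- the abstract correlation inequality and the bijection with padded path tuples
  obtain ⟨hfib, eW, heW⟩ := blk_pathIsWalk k m' σ hσ pos hpos0 hposS
  have h1 := scc_count hS T σ InG St hsymm' hrefl pos hpos0 hposS hG'
  -- padded path tuples ≃ path tuples × junk tuples
  let eP : (Fin (k + 1) → Fin m' → Fin k → Fin L → Fin n × Bool) ≃
      (Fin (k + 1) → Fin m → Fin k → Fin n × Bool) ×
        (Fin (k + 1) → Fin (m' * k * L - m * k) → Fin n × Bool) :=
    { toFun := fun Ψ' => (fun r => (e (Ψ' r)).1, fun r => (e (Ψ' r)).2)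
      invFun := fun ΨΘ r => e.symm (ΨΘ.1 r, ΨΘ.2 r)
      left_inv := fun Ψ' => funext fun r => by simp
      right_inv := fun ΨΘ => by ext r <;> simp }
  -- the checkpoint event downstairs
  set Ev : (Fin (k + 1) → Fin m → Fin k → Fin n × Bool) → Prop := fun Ψ =>
    (∀ r : Fin k, ∀ i ≤ m' * k,
      (fun (a : Fin m) (b : Fin k) =>
        if (a : ℕ) * k + b < i * L then Ψ r.succ a b else Ψ r.castSucc a b) ∈ G) ∧
    ∀ r : Fin k, ∀ i < m' * k,
      ¬ Far (fun (a : Fin m) (b : Fin k) =>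
          if (a : ℕ) * k + b < i * L then Ψ r.succ a b else Ψ r.castSucc a b)
        (fun (a : Fin m) (b : Fin k) =>
          if (a : ℕ) * k + b < (i + 1) * L then Ψ r.succ a b else Ψ r.castSucc a b) with hEv
  -- reading a checkpoint of a padded path tuple downstairs
  have hread : ∀ (Ψ' : Fin (k + 1) → Fin m' → Fin k → Fin L → Fin n × Bool) (r : Fin k) (i : ℕ),
      i ≤ m' * k →
      (fun (a : Fin m) (b : Fin k) =>
        if (a : ℕ) * k + b < i * L then (e (Ψ' r.succ)).1 a b else (e (Ψ' r.castSucc)).1 a b) =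
      (e (Function.curry (pos (eW Ψ').1 (eW Ψ').2 ((r : ℕ) * (m' * k) + i)))).1 := by
    intro Ψ' r i hi
    have hP : Function.curry (pos (eW Ψ').1 (eW Ψ').2 ((r : ℕ) * (m' * k) + i)) =
        fun (a' : Fin m') (c' : Fin k) =>
          if (a' : ℕ) * k + c' < i then Ψ' r.succ a' c' else Ψ' r.castSucc a' c' := by
      funext a' c'
      rw [heW Ψ' r i hi a' c']
      rfl
    rw [hP]
    funext a c
    obtain ⟨a', c', o, hidx, hfor⟩ := he a c
    rw [hfor, hfor, hfor]
    have hiff : (a : ℕ) * k + c < i * L ↔ (a' : ℕ) * k + c' < i := by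
      rw [hidx, Nat.div_lt_iff_lt_mul hL0]
    by_cases hlt : (a : ℕ) * k + c < i * L
    · rw [if_pos hlt, if_pos (hiff.1 hlt)]
    · rw [if_neg hlt, if_neg (fun h => hlt (hiff.2 h))]
  -- good walks, read downstairs, satisfy the checkpoint event
  have htime : ∀ (r : Fin k) (q : ℕ), q ≤ m' * k → (r : ℕ) * (m' * k) + q ≤ T := by
    intro r q hq
    calc (r : ℕ) * (m' * k) + q ≤ (r : ℕ) * (m' * k) + m' * k := by omega
      _ = ((r : ℕ) + 1) * (m' * k) := by ring
      _ ≤ k * (m' * k) := Nat.mul_le_mul_right _ r.isLt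
  have himp : ∀ Ψ' : Fin (k + 1) → Fin m' → Fin k → Fin L → Fin n × Bool,
      ((∀ t : Fin (T + 1), InG (pos (eW Ψ').1 (eW Ψ').2 t)) ∧
        ∀ t : Fin T, St (pos (eW Ψ').1 (eW Ψ').2 t) (pos (eW Ψ').1 (eW Ψ').2 ((t : ℕ) + 1))) →
      Ev (eP Ψ').1 := by
    rintro Ψ' ⟨hgood, hstab⟩
    have hfst : ∀ r', (eP Ψ').1 r' = (e (Ψ' r')).1 := fun r' => rfl
    constructor
    · intro r i hi
      simp only [hfst]
      rw [hread Ψ' r i hi]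
      exact (hInG _).1 (hgood ⟨_, Nat.lt_succ_of_le (htime r i hi)⟩)
    · intro r i hi
      simp only [hfst]
      rw [hread Ψ' r i hi.le, hread Ψ' r (i + 1) hi]
      have hlt : (r : ℕ) * (m' * k) + i < T := htime r (i + 1) hi
      have := (hSt _ _).1 (hstab ⟨_, hlt⟩)
      rw [show (r : ℕ) * (m' * k) + (i + 1) = (r : ℕ) * (m' * k) + i + 1 from (add_assoc _ _ _).symm]
      exact this
  -- hence the count of good walks is at most `#{Ψ : Ev Ψ} · #junk^{k+1}`
  have hcount : (((univ : Finset ((Fin m' × Fin k → (Fin L → Fin n × Bool)) ×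
      (Fin T → (Fin L → Fin n × Bool)))).filter fun vU =>
        (∀ t : Fin (T + 1), InG (pos vU.1 vU.2 t)) ∧
          ∀ t : Fin T, St (pos vU.1 vU.2 t) (pos vU.1 vU.2 ((t : ℕ) + 1))).card : ℝ) ≤
      ((univ.filter Ev).card : ℝ) *
        Fintype.card (Fin (k + 1) → Fin (m' * k * L - m * k) → Fin n × Bool) := by
    have step1 : ((univ : Finset ((Fin m' × Fin k → (Fin L → Fin n × Bool)) ×
        (Fin T → (Fin L → Fin n × Bool)))).filter fun vU =>
          (∀ t : Fin (T + 1), InG (pos vU.1 vU.2 t)) ∧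
            ∀ t : Fin T, St (pos vU.1 vU.2 t) (pos vU.1 vU.2 ((t : ℕ) + 1))).card =
        ((univ : Finset (Fin (k + 1) → Fin m' → Fin k → Fin L → Fin n × Bool)).filter fun Ψ' =>
          (∀ t : Fin (T + 1), InG (pos (eW Ψ').1 (eW Ψ').2 t)) ∧
            ∀ t : Fin T, St (pos (eW Ψ').1 (eW Ψ').2 t)
              (pos (eW Ψ').1 (eW Ψ').2 ((t : ℕ) + 1))).card := by
      refine (Finset.card_equiv eW fun Ψ' => ?_).symm
      simp only [mem_filter, mem_univ, true_and]
    have step2 : ((univ : Finset (Fin (k + 1) → Fin m' → Fin k → Fin L → Fin n × Bool)).filter fun Ψ' =>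
          (∀ t : Fin (T + 1), InG (pos (eW Ψ').1 (eW Ψ').2 t)) ∧
            ∀ t : Fin T, St (pos (eW Ψ').1 (eW Ψ').2 t)
              (pos (eW Ψ').1 (eW Ψ').2 ((t : ℕ) + 1))).card ≤
        ((univ : Finset (Fin (k + 1) → Fin m' → Fin k → Fin L → Fin n × Bool)).filter fun Ψ' =>
          Ev (eP Ψ').1).card :=
      Finset.card_le_card fun Ψ' hΨ' => by
        simp only [mem_filter, mem_univ, true_and] at hΨ' ⊢
        exact himp Ψ' hΨ'
    have step3 : ((univ : Finset (Fin (k + 1) → Fin m' → Fin k → Fin L → Fin n × Bool)).filter fun Ψ' =>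
          Ev (eP Ψ').1).card =
        (univ.filter Ev).card * Fintype.card (Fin (k + 1) → Fin (m' * k * L - m * k) → Fin n × Bool) := by
      rw [← Finset.card_univ, ← Finset.card_product]
      refine Finset.card_equiv eP fun Ψ' => ?_
      simp only [mem_filter, mem_univ, true_and, Finset.mem_product, and_true]
    have h := step1.trans_le step2
    rw [step3] at h
    exact_mod_cast h
  -- the pair counts in direction `j`: at most the `Far`-occurrences
  obtain ⟨far, hfar⟩ : ∃ far : Fin m' × Fin k → ℕ, ∀ j, far j =
      ((univ : Finset ((Fin m' × Fin k → (Fin L → Fin n × Bool)) × (Fin L → Fin n × Bool))).filter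
        fun p => ¬ St p.1 (Function.update p.1 j p.2)).card := ⟨_, fun _ => rfl⟩
  have hUfar : ∀ j : Fin m' × Fin k,
      (((univ : Finset ((Fin m' × Fin k → (Fin L → Fin n × Bool)) × (Fin L → Fin n × Bool))).filter
        fun p => InG p.1 ∧ (InG (Function.update p.1 j p.2) ∧
          ¬ St p.1 (Function.update p.1 j p.2))).card : ℝ) ≤ far j := fun j => by
    rw [hfar]
    exact_mod_cast Finset.card_le_card fun p hp => by
      simp only [mem_filter, mem_univ, true_and] at hp ⊢
      exact hp.2.2
  have hfar_curry : ∀ a' c', (far (a', c') : ℝ) =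
      ((univ : Finset ((Fin m' → Fin k → Fin L → Fin n × Bool) × (Fin L → Fin n × Bool))).filter
        fun p => Far (e p.1).1
          (e (Function.update p.1 a' (Function.update (p.1 a') c' p.2))).1).card := by
    intro a' c'
    rw [hfar]
    congr 1
    refine Finset.card_equiv ((Equiv.curry (Fin m') (Fin k) (Fin L → Fin n × Bool)).prodCongr
      (Equiv.refl _)) fun p => ?_
    simp only [mem_filter, mem_univ, true_and, hSt, not_not, Equiv.prodCongr_apply, Equiv.coe_refl,
      Prod.map_fst, Prod.map_snd, id_eq]
    rw [show Function.curry (Function.update p.1 (a', c') p.2) =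
      Function.update ((Equiv.curry (Fin m') (Fin k) (Fin L → Fin n × Bool)) p.1) a'
        (Function.update ((Equiv.curry (Fin m') (Fin k) (Fin L → Fin n × Bool)) p.1 a') c' p.2) from
      Function.curry_update p.1 (a', c') p.2]
    rfl
  have hfar_sum : (∑ j : Fin m' × Fin k, (far j : ℝ)) ≤ B := by
    rw [Fintype.sum_prod_type]
    simp only [hfar_curry]
    exact hB
  have hfar_T : (∑ t : Fin T, (far (σ t) : ℝ)) ≤ k * B := by
    rw [← Finset.sum_fiberwise' univ σ (fun j => (far j : ℝ))]
    have : ∑ j : Fin m' × Fin k, ∑ _t ∈ univ.filter (fun t => σ t = j), (far j : ℝ) =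
        k * ∑ j, (far j : ℝ) := by
      rw [Finset.mul_sum]
      refine Finset.sum_congr rfl fun j _ => ?_
      rw [Finset.sum_const, hfib j, nsmul_eq_mul]
    rw [this]
    have hk0 : (0 : ℝ) ≤ k := Nat.cast_nonneg k
    exact mul_le_mul_of_nonneg_left hfar_sum hk0
  -- the defect sum: `Σ_t Λ(σ t) ≤ 2 log(2N̂) √(V/N̂) √T √(kB)`
  have hlog0 : 0 ≤ Real.log (2 * (Fintype.card (Fin L → Fin n × Bool) : ℝ)) := by
    have h1 : (1 : ℝ) ≤ Fintype.card (Fin L → Fin n × Bool) := by exact_mod_cast hS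
    exact Real.log_nonneg (by linarith)
  have hΛt : ∀ t : Fin T, ∑ v ∈ univ.filter InG,
      ((((univ : Finset (Fin L → Fin n × Bool)).filter fun s => InG (Function.update v (σ t) s) ∧
          ¬ St v (Function.update v (σ t) s)).card : ℝ) + 1) /
        (((univ : Finset (Fin L → Fin n × Bool)).filter fun s =>
          InG (Function.update v (σ t) s)).card : ℝ) *
        Real.log ((((univ : Finset (Fin L → Fin n × Bool)).filter fun s =>
          InG (Function.update v (σ t) s) ∧ ¬ St v (Function.update v (σ t) s)).card : ℝ) + 1)
      ≤ 2 * Real.log (2 * (Fintype.card (Fin L → Fin n × Bool) : ℝ)) *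
          Real.sqrt ((Fintype.card (Fin m' × Fin k → (Fin L → Fin n × Bool)) : ℝ) /
            Fintype.card (Fin L → Fin n × Bool)) *
          Real.sqrt (far (σ t)) := fun t =>
    (scc_defect_le hS (σ t) InG St).trans
      (mul_le_mul_of_nonneg_left (Real.sqrt_le_sqrt (hUfar (σ t))) (by positivity))
  have hCS : ∑ t : Fin T, Real.sqrt (far (σ t)) ≤ Real.sqrt T * Real.sqrt (k * B) := by
    have h := (le_abs_self _).trans (Real.abs_le_sqrt
      (Finset.sum_mul_sq_le_sq_mul_sq (univ : Finset (Fin T)) (fun _ => (1 : ℝ))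
        (fun t => Real.sqrt (far (σ t)))))
    simp only [one_mul, one_pow, Finset.sum_const, Finset.card_univ, Fintype.card_fin,
      nsmul_eq_mul, mul_one] at h
    refine h.trans ?_
    rw [Real.sqrt_mul (Nat.cast_nonneg T)]
    refine mul_le_mul_of_nonneg_left (Real.sqrt_le_sqrt ?_) (Real.sqrt_nonneg _)
    calc ∑ t : Fin T, Real.sqrt (far (σ t)) ^ 2 = ∑ t : Fin T, (far (σ t) : ℝ) :=
          Finset.sum_congr rfl fun t _ => Real.sq_sqrt (Nat.cast_nonneg _)
      _ ≤ k * B := hfar_T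
  have hΛ : ∑ t : Fin T, ∑ v ∈ univ.filter InG,
      ((((univ : Finset (Fin L → Fin n × Bool)).filter fun s => InG (Function.update v (σ t) s) ∧
          ¬ St v (Function.update v (σ t) s)).card : ℝ) + 1) /
        (((univ : Finset (Fin L → Fin n × Bool)).filter fun s =>
          InG (Function.update v (σ t) s)).card : ℝ) *
        Real.log ((((univ : Finset (Fin L → Fin n × Bool)).filter fun s =>
          InG (Function.update v (σ t) s) ∧ ¬ St v (Function.update v (σ t) s)).card : ℝ) + 1)
      ≤ 2 * Real.log (2 * (Fintype.card (Fin L → Fin n × Bool) : ℝ)) *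
          Real.sqrt ((Fintype.card (Fin m' × Fin k → (Fin L → Fin n × Bool)) : ℝ) /
            Fintype.card (Fin L → Fin n × Bool)) *
          (Real.sqrt T * Real.sqrt (k * B)) := by
    refine (Finset.sum_le_sum fun t _ => hΛt t).trans ?_
    rw [← Finset.mul_sum]
    exact mul_le_mul_of_nonneg_left hCS (by positivity)
  -- compare the exponents
  have hGJ : (((univ : Finset (Fin m' × Fin k → (Fin L → Fin n × Bool))).filter InG).card : ℝ) =
      G.card * (2 * n : ℝ) ^ (m' * k * L - m * k) := by
    rw [hGcard, Nat.cast_mul, hcJ]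
  have hGJpos : (0 : ℝ) < G.card * (2 * n : ℝ) ^ (m' * k * L - m * k) := by
    rw [← hcJ]; exact mul_pos hGpos hJpos
  have hexp : Real.exp (-(2 * Real.log (2 * (2 * n : ℝ) ^ L) /
        (G.card * (2 * n : ℝ) ^ (m' * k * L - m * k)) *
      Real.sqrt (((2 * n : ℝ) ^ L) ^ (m' * k) / (2 * n : ℝ) ^ L) *
      Real.sqrt ((T : ℝ) * (k * B)))) ≤
      Real.exp (-(((((univ : Finset (Fin m' × Fin k → (Fin L → Fin n × Bool))).filter InG).card : ℝ))⁻¹ *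
        ∑ t : Fin T, ∑ v ∈ univ.filter InG,
          ((((univ : Finset (Fin L → Fin n × Bool)).filter fun s => InG (Function.update v (σ t) s) ∧
              ¬ St v (Function.update v (σ t) s)).card : ℝ) + 1) /
            (((univ : Finset (Fin L → Fin n × Bool)).filter fun s =>
              InG (Function.update v (σ t) s)).card : ℝ) *
            Real.log ((((univ : Finset (Fin L → Fin n × Bool)).filter fun s =>
              InG (Function.update v (σ t) s) ∧ ¬ St v (Function.update v (σ t) s)).card : ℝ) + 1))) := by
    rw [Real.exp_le_exp, neg_le_neg_iff]
    have hG0 : (0 : ℝ) ≤ ((((univ : Finset (Fin m' × Fin k → (Fin L → Fin n × Bool))).filter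
      InG).card : ℝ))⁻¹ := by rw [hGJ]; exact (inv_pos.2 hGJpos).le
    refine (mul_le_mul_of_nonneg_left hΛ hG0).trans (le_of_eq ?_)
    rw [hGJ, hcSB, hcV, Real.sqrt_mul (Nat.cast_nonneg T) ((k : ℝ) * B)]
    field_simp
  -- assemble: `h1` + `hcount`, then divide by `#junk^{k+1}`
  have hcount' := h1.trans hcount
  -- `#V · N̂^T = #paths · #junk^{k+1}`
  have hJKpos : (0 : ℝ) < Fintype.card (Fin (k + 1) → Fin (m' * k * L - m * k) → Fin n × Bool) := by
    exact_mod_cast Fintype.card_pos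
  have hPP : (Fintype.card (Fin (k + 1) → Fin m' → Fin k → Fin L → Fin n × Bool) : ℝ) =
      (Fintype.card (Fin (k + 1) → Fin m → Fin k → Fin n × Bool) : ℝ) *
        Fintype.card (Fin (k + 1) → Fin (m' * k * L - m * k) → Fin n × Bool) := by
    rw [Fintype.card_congr eP, Fintype.card_prod]; push_cast; ring
  have hVT : (Fintype.card (Fin m' × Fin k → (Fin L → Fin n × Bool)) : ℝ) *
      (Fintype.card (Fin L → Fin n × Bool) : ℝ) ^ T =
      (Fintype.card (Fin (k + 1) → Fin m → Fin k → Fin n × Bool) : ℝ) *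
        Fintype.card (Fin (k + 1) → Fin (m' * k * L - m * k) → Fin n × Bool) := by
    rw [← hPP, Fintype.card_fun (α := Fin (k + 1)), Fintype.card_fin, ← hcVPI, Nat.cast_pow,
      Fintype.card_fun (α := Fin m' × Fin k), Fintype.card_prod, Fintype.card_fin, Fintype.card_fin,
      Nat.cast_pow, hT, ← pow_mul, ← pow_add]
    congr 1
    ring
  -- the density upstairs equals the density downstairs
  have hdens : ((((univ : Finset (Fin m' × Fin k → (Fin L → Fin n × Bool))).filter InG).card : ℝ) /
      Fintype.card (Fin m' × Fin k → (Fin L → Fin n × Bool))) =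
      (G.card : ℝ) / Fintype.card (Fin m → Fin k → Fin n × Bool) := by
    rw [hGcard, hcVPI, hcPI]
    push_cast
    rw [mul_div_mul_right _ _ hJpos.ne']
  rw [hdens, hVT] at hcount'
  -- divide by `#junk^{k+1}`
  have hfin : (Fintype.card (Fin (k + 1) → Fin m → Fin k → Fin n × Bool) : ℝ) *
      ((G.card : ℝ) / Fintype.card (Fin m → Fin k → Fin n × Bool)) ^ (T + 1) *
      Real.exp (-(2 * Real.log (2 * (2 * n : ℝ) ^ L) /
          (G.card * (2 * n : ℝ) ^ (m' * k * L - m * k)) *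
        Real.sqrt (((2 * n : ℝ) ^ L) ^ (m' * k) / (2 * n : ℝ) ^ L) *
        Real.sqrt ((T : ℝ) * (k * B)))) *
      Fintype.card (Fin (k + 1) → Fin (m' * k * L - m * k) → Fin n × Bool) ≤
      ((univ.filter Ev).card : ℝ) *
        Fintype.card (Fin (k + 1) → Fin (m' * k * L - m * k) → Fin n × Bool) := by
    refine le_trans ?_ hcount'
    have hrew : (Fintype.card (Fin (k + 1) → Fin m → Fin k → Fin n × Bool) : ℝ) *
        ((G.card : ℝ) / Fintype.card (Fin m → Fin k → Fin n × Bool)) ^ (T + 1) *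
        Real.exp (-(2 * Real.log (2 * (2 * n : ℝ) ^ L) /
            (G.card * (2 * n : ℝ) ^ (m' * k * L - m * k)) *
          Real.sqrt (((2 * n : ℝ) ^ L) ^ (m' * k) / (2 * n : ℝ) ^ L) *
          Real.sqrt ((T : ℝ) * (k * B)))) *
        Fintype.card (Fin (k + 1) → Fin (m' * k * L - m * k) → Fin n × Bool) =
        (Fintype.card (Fin (k + 1) → Fin m → Fin k → Fin n × Bool) : ℝ) *
          Fintype.card (Fin (k + 1) → Fin (m' * k * L - m * k) → Fin n × Bool) *
          ((G.card : ℝ) / Fintype.card (Fin m → Fin k → Fin n × Bool)) ^ (T + 1) *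
          Real.exp (-(2 * Real.log (2 * (2 * n : ℝ) ^ L) /
              (G.card * (2 * n : ℝ) ^ (m' * k * L - m * k)) *
            Real.sqrt (((2 * n : ℝ) ^ L) ^ (m' * k) / (2 * n : ℝ) ^ L) *
            Real.sqrt ((T : ℝ) * (k * B)))) := by ring
    rw [hrew]
    exact mul_le_mul_of_nonneg_left hexp (by positivity)
  have := le_of_mul_le_mul_right hfin hJKpos
  simpa only [hT] using this

end Summit.PneNP.PneNP.Theorems
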